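import Summits.QuantumFields.YangMills.Theorems.TwistedTraceScaling.Negative.ValleyLinkProxExponent
import HarnessLib

/-!
# Negative lemma R12b (crux `TwistedTraceScaling`, stmt-QuantumFields-20203): strictly below the line `q = 4p` even the `O(δ)` proximity texts fail —
# no constant `C` makes the valley set `C·δ`-link-close (every `L ≥ 1`) or `C·δ`-`covCurl`-close (`L ≥ 2`) to the gauge-torons

Standing disprover `ym-cdisprove-20203-1` (gen 11), companion of `…Negative.ValleyLinkProxExponent` (R12).  R11/R12 refute the `∀ ε` texts
`ValleyGeomAt` / `ValleyLinkProxAt` for `q ≤ 4p`.  The C3 skeleton `valleyKernelRowBoundAt_of_bo_geom` consumes GEOM at ONE tolerance `εG(L, κ, c₀)` only, so the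
honest weakest form of the proximity input is a FIXED-constant (`O(δ)`) text.  This file kills those too, in the regime `δ⁴ = o(η)` («for every `M > 0`,
`0 < δ β ∧ δ β⁴ ≤ M·η β` frequently» — e.g. `(β^{−p}, β^{−q})` with `q < 4p`):
* `exists_scale` — for `B ≥ 0`, `P > 0` a regime constant `M > 0` with `B·(4N + 2√N) ≤ 1`, `N = √(MP)` (`M = t⁴/P`, `t = 1/(6B+1)`);
* ★ `valleyLinkProxBigO_false (L) [NeZero L] … : ¬ ∃ C β₀, ∀ β ≥ β₀, ∀ U ∈ valleySet L (δ β) (η β), ∃ W g θ, U = W·(g·V_θ) ∧ (0 ≤ scalarPart W_e) ∧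
  |vecPart(W_e)_c| ≤ C·δ β` — EVERY `L ≥ 1`;
* ★ `valleyGeomBigO_false (L) [NeZero L] (hL : 2 ≤ L) … : ¬ ∃ C β₀, ∀ β ≥ β₀, ∀ U ∈ valleySet L (δ β) (η β), ∃ g θ, ∀ v,
  ‖D_U v − D_{g·V_θ} v‖ ≤ C·δ β·‖v‖` (no twist-size clause needed);
* `powScale_dom (q < 4p) (0 < M) : ∀ᶠ β, 0 < β^{−p} ∧ (β^{−p})⁴ ≤ M·β^{−q}` and the corollaries ★ `valleyLinkProxBigO_pow_false`,
  ★ `valleyGeomBigO_pow_false` for `0 < p`, `0 < q < 4p`.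
Since `ValleyLinkProxAt → (the O(δ) link text)` (take `ε = C = 1`), these subsume R12/R11 strictly below the line; ON the line `q = 4p` only the `∀ ε`
texts are refuted (the scheme there needs `C < 1/(8(4N+2√N))`, `N = √(4#P+1)`), so an `O(δ)` statement with a LARGE constant at `q = 4p` stays open.
MECHANISM: `R12.dom_scheme` with `A = 4√3·C` (links) / `A = 6C` (transports, via R11's sign lift on single-link test vectors) and the regime constant
`M(C, L)` of `exists_scale`, applied to `hdom M`.
READING for lane A (COARSE-DESIGN §16): for `q < 4p` no weakening of GEOM / LinkProx to a fixed tolerance can rescue the skeleton's inputs — for every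
`C`, frequently in `β`, the valley set contains a point MORE than `C·δ β` away (linkwise, and in `covCurl`) from every gauge-toron (the R10 witness sits at distance
`≍ (η β)^{1/4} ≫ δ β` when `δ β⁴ ≪ η β`); the exponent line is a property of the SET `valleySet L (β^{−p}) (β^{−q})`, not of the tolerance bookkeeping.
HONEST FRAMING: fixed-lattice `SU(2)` geometry about typed sub-targets of a stub (S-BASE C3) of a child of the CONDITIONAL reduction route (femto rung
R2b1); `q > 4p`, `ValleyBOAt`, C3/C4 stay OPEN; not `¬TwistedTraceScaling`, not infinite volume, not a gap, not Clay.
Sorry-free, no new definition; axioms ⊆ {propext, Classical.choice, Quot.sound}.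
-/

set_option autoImplicit false

noncomputable section

open Filter Topology
open scoped Matrix Quaternion BigOperators
open Literature.MathematicalPhysics.QuantumFieldTheory hiding SU2
open Literature.MathematicalPhysics.QuantumLattice
open Summit.QuantumFields.YangMills.Theorems.FemtoTransferGap
open Summit.QuantumFields.YangMills.Theorems.FemtoTransferGap.PhysL2 (twoLinkCfg)
open Summit.QuantumFields.YangMills.Theorems.FemtoTransferGap.TwoLattice.Stiff (LinkSpace)
open Summit.QuantumFields.YangMills.Theorems.FemtoTransferGap.TwoLattice.Cov (covCurl)
open Summit.QuantumFields.YangMills.Theorems.FemtoTransferGap.TwoLattice.Toron (abelianCfg)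
open Summit.QuantumFields.YangMills.Theorems.TwistedTraceScaling.Negative.R8
open Summit.QuantumFields.YangMills.Theorems.TwistedTraceScaling.Negative.R10
open Summit.QuantumFields.YangMills.Theorems.TwistedTraceScaling.Negative.R11

namespace Summit.QuantumFields.YangMills.Theorems.TwistedTraceScaling.Negative.R12

/-! ## §1 The regime constant -/

section Scale

/-- For `B ≥ 0` and `P > 0` there is `M > 0` with `B·(4√(MP) + 2√√(MP)) ≤ 1`: take `t = 1/(6B+1)`, `M = t⁴/P`, so `√(MP) = t²`, `√√(MP) = t` and
`B(4t² + 2t) ≤ 6Bt ≤ 1`. [folklore] -/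
theorem exists_scale {B P : ℝ} (hB : 0 ≤ B) (hP : 0 < P) :
    ∃ M : ℝ, 0 < M ∧ B * (4 * Real.sqrt (M * P) + 2 * Real.sqrt (Real.sqrt (M * P))) ≤ 1 := by
  set t : ℝ := 1 / (6 * B + 1) with ht
  have hden : 0 < 6 * B + 1 := by positivity
  have ht0 : 0 < t := by positivity
  have ht1 : t ≤ 1 := by rw [ht, div_le_one hden]; linarith only [hB]
  have htB : 6 * B * t ≤ 1 := by rw [ht, mul_one_div, div_le_one hden]; linarith only [hB]
  refine ⟨t ^ 4 / P, by positivity, ?_⟩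
  have hMP : t ^ 4 / P * P = (t ^ 2) ^ 2 := by rw [div_mul_cancel₀ _ hP.ne']; ring
  have h1 : Real.sqrt (t ^ 4 / P * P) = t ^ 2 := by rw [hMP, Real.sqrt_sq (sq_nonneg t)]
  have h2 : Real.sqrt (t ^ 2) = t := Real.sqrt_sq ht0.le
  rw [h1, h2]
  have ht2 : t ^ 2 ≤ t := by nlinarith only [ht0, ht1]
  nlinarith only [mul_nonneg hB (sub_nonneg.2 ht2), htB, hB, ht0]

/-- At lane A's scales with `q < 4p` the regime `δ⁴ = o(η)` holds: for every `M > 0`, eventually `0 < β^{−p}` and `(β^{−p})⁴ ≤ M·β^{−q}`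
(`(β^{−p})⁴ = β^{−(4p−q)}·β^{−q}` and `β^{−(4p−q)} → 0`). [folklore] -/
theorem powScale_dom {p q : ℝ} (hqp : q < 4 * p) {M : ℝ} (hM : 0 < M) :
    ∀ᶠ β in atTop, 0 < powScale p β ∧ powScale p β ^ 4 ≤ M * powScale q β := by
  have ht : Tendsto (powScale (4 * p - q)) atTop (𝓝 0) := tendsto_powScale (by linarith only [hqp])
  filter_upwards [ht.eventually_lt_const hM] with β hβ
  refine ⟨powScale_pos p β, ?_⟩
  have hb : 1 ≤ max β 1 := le_max_right _ _
  have hb0 : 0 < max β 1 := one_pos.trans_le hb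
  have h4 : powScale p β ^ 4 = powScale (4 * p - q) β * powScale q β := by
    rw [powScale, powScale, powScale, ← Real.rpow_natCast, ← Real.rpow_mul hb0.le, ← Real.rpow_add hb0]
    congr 1; push_cast; ring
  rw [h4]
  exact mul_le_mul_of_nonneg_right hβ.le (powScale_pos q β).le

end Scale

/-! ## §2 ★ The `O(δ)` proximity texts are false in the regime `δ⁴ = o(η)` -/

section BigO

variable {L : ℕ}

set_option maxHeartbeats 400000 in
/-- ★ **R12b (links). No constant `C` makes the valley set `C·δ`-link-close to the gauge-torons when `δ⁴ = o(η)`** — every `L ≥ 1`.  If `δ, η → 0` and for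
every `M > 0` frequently `0 < δ β ∧ δ β⁴ ≤ M·η β`, then there are NO `C, β₀` such that beyond `β₀` every `U ∈ valleySet L (δ β) (η β)` is `U = W·(g·V_θ)` with an
upper-hemisphere step `W`, `|vecPart(W_e)_c| ≤ C·δ β`: `dom_scheme` at `A = 4√3·C` with the regime constant `M(8|C|, 4#P+1)` of `exists_scale`. [cite: Luscher1983, §2] -/
theorem valleyLinkProxBigO_false (L : ℕ) [NeZero L] {δ η : ℝ → ℝ} (hδ : Tendsto δ atTop (𝓝 0)) (hη : Tendsto η atTop (𝓝 0))
    (hdom : ∀ M : ℝ, 0 < M → ∃ᶠ β in atTop, 0 < δ β ∧ δ β ^ 4 ≤ M * η β) :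
    ¬ ∃ C β₀ : ℝ, ∀ β : ℝ, β₀ ≤ β → ∀ U ∈ valleySet L (δ β) (η β),
      ∃ (W : GaugeConfig 3 L SU2) (g : Site 3 L → SU2) (θ : Fin 3 → ℝ),
        U = W * gaugeTransform g (abelianCfg L θ) ∧ (∀ e, 0 ≤ scalarPart (W e)) ∧ ∀ (e : Edge 3 L) (c : Fin 3), |vecPart (W e) c| ≤ C * δ β := by
  rintro ⟨C, β₀, H⟩
  obtain ⟨M, hM, hB⟩ := exists_scale (B := 8 * |C|) (P := 4 * (Fintype.card (Plaquette 3 L) : ℝ) + 1) (by positivity) (by positivity)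
  refine dom_scheme L hδ hη hM (hdom M hM) β₀ (A := 4 * Real.sqrt 3 * C) ?_ ?_
  · have hX : 0 ≤ 4 * Real.sqrt (M * (4 * (Fintype.card (Plaquette 3 L) : ℝ) + 1)) +
        2 * Real.sqrt (Real.sqrt (M * (4 * (Fintype.card (Plaquette 3 L) : ℝ) + 1))) := by positivity
    have h2 : |4 * Real.sqrt 3 * C| ≤ 8 * |C| := by
      rw [abs_mul, abs_of_nonneg (by positivity : (0 : ℝ) ≤ 4 * Real.sqrt 3)]
      exact mul_le_mul_of_nonneg_right (by linarith only [sqrt_three_le_two]) (abs_nonneg C)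
    exact (mul_le_mul_of_nonneg_right (le_abs_self _) hX).trans ((mul_le_mul_of_nonneg_right h2 hX).trans hB)
  · intro β hβ _ _ a b α τ ha hb hmem _ _ _
    obtain ⟨W, g, θ', hUeq, hs, hw⟩ := H β hβ _ hmem
    have hlink : ∀ (y : Site 3 L) (k : Fin 3), k ≠ 2 →
        frobNorm (((twoLinkCfg (L := L) a b (y, k) : SU2) : Matrix (Fin 2) (Fin 2) ℂ) -
            ((gaugeTransform g (abelianCfg L θ') (y, k) : SU2) : Matrix (Fin 2) (Fin 2) ℂ)) ≤ 2 * Real.sqrt 3 * (C * δ β) ∨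
          frobNorm (((twoLinkCfg (L := L) a b (y, k) : SU2) : Matrix (Fin 2) (Fin 2) ℂ) -
            ((negOne * gaugeTransform g (abelianCfg L θ') (y, k) : SU2) : Matrix (Fin 2) (Fin 2) ℂ)) ≤ 2 * Real.sqrt 3 * (C * δ β) := by
      intro y k _
      left
      rw [hUeq]
      exact frobNorm_step_link_sub_le W _ (y, k) (hs (y, k)) (hw (y, k))
    calc min (Real.sin (L * α)) (Real.sin (L * τ)) ≤ 2 * (L * (2 * Real.sqrt 3 * (C * δ β))) := min_sin_le_of_near_toron ha hb g θ' hlink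
      _ = 4 * Real.sqrt 3 * C * (L * δ β) := by ring

set_option maxHeartbeats 400000 in
/-- ★ **R12b (transports). No constant `C` makes the valley set `C·δ`-`covCurl`-close to the gauge-torons when `δ⁴ = o(η)`** (`L ≥ 2`).  If `δ, η → 0` and
for every `M > 0` frequently `0 < δ β ∧ δ β⁴ ≤ M·η β`, then there are NO `C, β₀` such that beyond `β₀` every `U ∈ valleySet L (δ β) (η β)` admits `g, θ` with
`‖D_U v − D_{g·V_θ} v‖ ≤ C·δ β·‖v‖` for all `v` (the twist-size clause of `ValleyGeomAt` is not even needed): single-link test vectors + R11's sign lift give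
`±`-link closeness `3Cδ`, and `dom_scheme` at `A = 6C` with the regime constant `M(6|C|, 4#P+1)`. [cite: Luscher1983, §2–§3] -/
theorem valleyGeomBigO_false (L : ℕ) [NeZero L] (hL : 2 ≤ L) {δ η : ℝ → ℝ} (hδ : Tendsto δ atTop (𝓝 0)) (hη : Tendsto η atTop (𝓝 0))
    (hdom : ∀ M : ℝ, 0 < M → ∃ᶠ β in atTop, 0 < δ β ∧ δ β ^ 4 ≤ M * η β) :
    ¬ ∃ C β₀ : ℝ, ∀ β : ℝ, β₀ ≤ β → ∀ U ∈ valleySet L (δ β) (η β), ∃ (g : Site 3 L → SU2) (θ : Fin 3 → ℝ),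
      ∀ v : LinkSpace L, ‖covCurl U v - covCurl (gaugeTransform g (abelianCfg L θ)) v‖ ≤ C * δ β * ‖v‖ := by
  rintro ⟨C, β₀, H⟩
  obtain ⟨M, hM, hB⟩ := exists_scale (B := 6 * |C|) (P := 4 * (Fintype.card (Plaquette 3 L) : ℝ) + 1) (by positivity) (by positivity)
  refine dom_scheme L hδ hη hM (hdom M hM) β₀ (A := 6 * C) ?_ ?_
  · have hX : 0 ≤ 4 * Real.sqrt (M * (4 * (Fintype.card (Plaquette 3 L) : ℝ) + 1)) +
        2 * Real.sqrt (Real.sqrt (M * (4 * (Fintype.card (Plaquette 3 L) : ℝ) + 1))) := by positivity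
    have h2 : |6 * C| ≤ 6 * |C| := by rw [abs_mul, abs_of_nonneg (by norm_num : (0 : ℝ) ≤ 6)]
    exact (mul_le_mul_of_nonneg_right (le_abs_self _) hX).trans ((mul_le_mul_of_nonneg_right h2 hX).trans hB)
  · intro β hβ _ _ a b α τ ha hb hmem _ _ _
    obtain ⟨g, θ', hclose⟩ := H β hβ _ hmem
    have hlink : ∀ (y : Site 3 L) (k : Fin 3), k ≠ 2 →
        frobNorm (((twoLinkCfg (L := L) a b (y, k) : SU2) : Matrix (Fin 2) (Fin 2) ℂ) -
            ((gaugeTransform g (abelianCfg L θ') (y, k) : SU2) : Matrix (Fin 2) (Fin 2) ℂ)) ≤ 3 * (C * δ β) ∨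
          frobNorm (((twoLinkCfg (L := L) a b (y, k) : SU2) : Matrix (Fin 2) (Fin 2) ℂ) -
            ((negOne * gaugeTransform g (abelianCfg L θ') (y, k) : SU2) : Matrix (Fin 2) (Fin 2) ℂ)) ≤ 3 * (C * δ β) := by
      intro y k hk
      have hk' : k = 0 ∨ k = 1 := by
        rcases Fin.eq_zero_or_eq_succ k with h | ⟨j, rfl⟩
        · exact Or.inl h
        · rcases Fin.eq_zero_or_eq_succ j with h | ⟨i, rfl⟩
          · right; rw [h]; rfl
          · exact absurd (by rw [Fin.eq_zero i]; rfl) hk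
      rcases hk' with rfl | rfl
      · exact frobNorm_sub_le_or_of_adRot fun c d =>
          abs_adRot_sub_le_of_covCurl hclose y ⟨(0, 1), by decide⟩ (shift_ne_self hL y 0) c d
      · exact frobNorm_sub_le_or_of_adRot fun c d =>
          abs_adRot_sub_le_of_covCurl hclose y ⟨(1, 2), by decide⟩ (shift_ne_self hL y 1) c d
    calc min (Real.sin (L * α)) (Real.sin (L * τ)) ≤ 2 * (L * (3 * (C * δ β))) := min_sin_le_of_near_toron ha hb g θ' hlink
      _ = 6 * C * (L * δ β) := by ring

/-- ★ **R12b at lane A's scales (links), `0 < q < 4p`, every `L ≥ 1`**: no constant `C` makes `valleySet L (β^{−p}) (β^{−q})` eventually `C·β^{−p}`-link-close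
to the gauge-torons. [cite: Luscher1983, §2] -/
theorem valleyLinkProxBigO_pow_false (L : ℕ) [NeZero L] {p q : ℝ} (hp : 0 < p) (hq : 0 < q) (hqp : q < 4 * p) :
    ¬ ∃ C β₀ : ℝ, ∀ β : ℝ, β₀ ≤ β → ∀ U ∈ valleySet L (powScale p β) (powScale q β),
      ∃ (W : GaugeConfig 3 L SU2) (g : Site 3 L → SU2) (θ : Fin 3 → ℝ),
        U = W * gaugeTransform g (abelianCfg L θ) ∧ (∀ e, 0 ≤ scalarPart (W e)) ∧
          ∀ (e : Edge 3 L) (c : Fin 3), |vecPart (W e) c| ≤ C * powScale p β :=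
  valleyLinkProxBigO_false L (tendsto_powScale hp) (tendsto_powScale hq) fun _ hM => (powScale_dom hqp hM).frequently

/-- ★ **R12b at lane A's scales (transports), `0 < q < 4p`, `L ≥ 2`**: no constant `C` makes `valleySet L (β^{−p}) (β^{−q})` eventually
`C·β^{−p}`-`covCurl`-close to the gauge-torons. [cite: Luscher1983, §2–§3] -/
theorem valleyGeomBigO_pow_false (L : ℕ) [NeZero L] (hL : 2 ≤ L) {p q : ℝ} (hp : 0 < p) (hq : 0 < q) (hqp : q < 4 * p) :
    ¬ ∃ C β₀ : ℝ, ∀ β : ℝ, β₀ ≤ β → ∀ U ∈ valleySet L (powScale p β) (powScale q β), ∃ (g : Site 3 L → SU2) (θ : Fin 3 → ℝ),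
      ∀ v : LinkSpace L, ‖covCurl U v - covCurl (gaugeTransform g (abelianCfg L θ)) v‖ ≤ C * powScale p β * ‖v‖ :=
  valleyGeomBigO_false L hL (tendsto_powScale hp) (tendsto_powScale hq) fun _ hM => (powScale_dom hqp hM).frequently

/-- Consistency: the `O(δ)` link text is implied by `ValleyLinkProxAt` (take `ε = C = 1`), so `valleyLinkProxBigO_false` re-derives R12 strictly
below the line. -/
example (L : ℕ) [NeZero L] {δ η : ℝ → ℝ} (hδ : Tendsto δ atTop (𝓝 0)) (hη : Tendsto η atTop (𝓝 0))
    (hdom : ∀ M : ℝ, 0 < M → ∃ᶠ β in atTop, 0 < δ β ∧ δ β ^ 4 ≤ M * η β) : ¬ ValleyLinkProxAt L δ η := fun h =>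
  valleyLinkProxBigO_false L hδ hη hdom (by obtain ⟨β₀, hβ⟩ := h 1 one_pos; exact ⟨1, β₀, hβ⟩)

end BigO

end Summit.QuantumFields.YangMills.Theorems.TwistedTraceScaling.Negative.R12

end
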